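import Summits.QuantumFields.YangMills.Theorems.IR.EsPolymerCovBoundK
import Literature.MathematicalPhysics.QuantumFieldTheory.AdhikariCao2022.SwappingLemma

/-!
# Crux `IR` (item stmt-QuantumFields-19354) — line «es-polymer-decoupling», reshaped engine, input (c), part 1/3:
# THE SWAP ON THE `B`-CLUSTER OF TWO INDEPENDENT COPIES OF THE HARD-CORE CELL GAS IS A SWAPPING MAP

Helper module for item `stmt-QuantumFields-19354` (`--supports … --as helper`; it closes nothing).  Input (c) of the open
engine stub `stub_polymerEngineK : PolymerEngineK` (`Theorems/IR/EsPolymerDefsK.lean`), named missing by the lead: «two-region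
exponential mixing of the hard-core KP cell gas for near-family functionals».  It is obtained in three files WITHOUT a
cluster expansion: by the SWAPPING LEMMA of Adhikari–Cao (Def. 3.1 / Lemma 3.2, PROVED in the tree:
`AdhikariCao2022.IsSwappingMap`, `AdhikariCao2022.norm_fcov_le_of_isSwappingMap`) applied to two independent copies of the
gas — the exchange-on-the-cluster move of van den Berg's disagreement coupling, transplanted from Markov fields to the
hard-core polymer gas.

This file: the hard-core gas `g(Γ) = Z⁻¹ ∏_{γ∈Γ} act γ` (clause (P) of `DPRk` read on total masses) lives on
`Ω = Finset (Finset (Cell q))`; on `Ω × Ω` let `K = clusterB (Γ ∪ Γ′) c_B k` be the polymers of `Γ ∪ Γ′` joined to a polymer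
near the radius-`k` block about `c_B` by a chain of polymers of `Γ ∪ Γ′` with consecutive members touching (cells at cell
distance `≤ 6`), and let `swap` EXCHANGE the two copies on `K`.  Then `swap` is an involution preserving `Γ ∪ Γ′`, hence `K`,
hence the good event `good` = «no polymer of `K` is near the `A`-block» (`swap_swap`, `swap_mem_good_iff`); it preserves
compatibility of each copy (a polymer of `Γ ∖ K` touching `K` would belong to `K`: `compatible_mix`) and the product of
activities (`prod_swap`); on `good` the near-`A` family of the first copy is unchanged and its near-`B` family becomes that
of the second copy (`nearFamily_swap_fst_A/B`).  Hence `swap_isSwappingMap`: `swap` is a swapping map for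
`(g, good, Φ_A ∘ nearFamily_A, Φ_B ∘ nearFamily_B)`.  Parts 2/3 (`EsPolymerGasPeierls2K`: the two-copy Peierls bound of the
bad event and the lattice-animal tail) and 3/3 (`EsPolymerGasMixingK`: the covariance bounds) follow.

HONEST FRAMING: elementary finite combinatorics for ONE input of an OPEN, PROVABLE engine stub of a CONDITIONAL rung
line; the load of that line, `stub_polymerCertK : IRPolymerCertK` (a disjoint-polymer representation of lattice
Yang–Mills at every large β — the weak-coupling mass gap in polymer clothes), is untouched; nothing here proves
clustering of lattice Yang–Mills, `BalabanLadder.IR`, or the Clay Yang–Mills problem; R4 closes only the conditional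
finite-𝕋⁴ rung `BalabanLadder.UV`.  No `Prop`-valued definitions, no Theses conclusion.  Authored by the ideator seat
ym-ir-idea-1 (g7) as a stub-level service for the lead prover ym-ir-line-mxc-p1 (RULING g9-№2; line verdicts crit-1 /
crit-2 PASS-WITH-PRICE 2026-08-28T00:01Z / 00:04Z: engine allowed, no prover on the load).
References: [cite: AdhikariCao2025, Def. 3.1 / Lemma 3.2]; [cite: Vandenberg1993]; [cite: GeorgiiHaggstromMaes2001,
Prop. 7.10]; for the hard-core lattice gas cf. van den Berg–Steif, Stoch. Proc. Appl. 49 (1994) 179–197, §2.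
-/

set_option autoImplicit false

noncomputable section

open Finset Function
open Literature.MathematicalPhysics.QuantumFieldTheory
open Literature.MathematicalPhysics.QuantumFieldTheory.AdhikariCao2022 (IsSwappingMap)

namespace Summit.QuantumFields.YangMills.Cruxes.IR.EsPolymer

namespace GasMixing

variable {q : ℕ}

/-! ## §1 Vocabulary: cells of a family, the `B`-cluster, the swap, the good event, the contours, touching-components

(No `Prop`-valued definitions: «near the radius-`k` block about `c`» = `∃ c' ∈ γ, cellDist c c' ≤ k + 1` (as in
`nearFamily`) and «touch» = `∃ c ∈ γ, ∃ c' ∈ γ', cellDist c c' ≤ 6` (the negation of the hard core of `Compatible`) are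
written out.) -/

/-- The cells of a family. -/
def cells (F : Finset (Finset (Cell q))) : Finset (Cell q) := F.biUnion id

open Classical in
/-- The `B`-cluster of a family `Δ` (in the application `Δ = Γ ∪ Γ′`): the members of `Δ` joined to a member of `Δ` near the
radius-`k` block about `c_B` by a chain of members of `Δ` with consecutive ones touching (cells at cell distance `≤ 6`). -/
def clusterB (Δ : Finset (Finset (Cell q))) (cB : Cell q) (k : ℕ) : Finset (Finset (Cell q)) :=
  Δ.filter fun γ => ∃ γ₀ ∈ Δ, (∃ c' ∈ γ₀, cellDist cB c' ≤ k + 1) ∧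
    Relation.ReflTransGen (fun x y => x ∈ Δ ∧ y ∈ Δ ∧ ∃ c ∈ x, ∃ c' ∈ y, cellDist c c' ≤ 6) γ₀ γ

/-- Exchange two families on a set of polymers `K`. -/
def swapWith (K : Finset (Finset (Cell q))) (p : Finset (Finset (Cell q)) × Finset (Finset (Cell q))) :
    Finset (Finset (Cell q)) × Finset (Finset (Cell q)) :=
  ((p.1 \ K) ∪ (p.2 ∩ K), (p.2 \ K) ∪ (p.1 ∩ K))

/-- **The swap**: exchange the two copies on the `B`-cluster of their union. -/
def swap (cB : Cell q) (k : ℕ) (p : Finset (Finset (Cell q)) × Finset (Finset (Cell q))) :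
    Finset (Finset (Cell q)) × Finset (Finset (Cell q)) :=
  swapWith (clusterB (p.1 ∪ p.2) cB k) p

open Classical in
/-- **The good event**: every polymer of the `B`-cluster of `Γ ∪ Γ′` keeps cell distance `> k + 1` from `c_A` (is not near
the `A`-block). -/
def good (cA cB : Cell q) (k : ℕ) : Finset (Finset (Finset (Cell q)) × Finset (Finset (Cell q))) :=
  Finset.univ.filter fun p => ∀ γ ∈ clusterB (p.1 ∪ p.2) cB k, ∀ c' ∈ γ, k + 1 < cellDist cA c'

open Classical in
/-- The Peierls contours of the bad event: polymers (nonempty `6`-connected cell sets, the tree's `IsPolymer`) near BOTH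
radius-`k` blocks. -/
def animals (cA cB : Cell q) (k : ℕ) : Finset (Finset (Cell q)) :=
  Finset.univ.filter fun X => IsPolymer X ∧ (∃ c' ∈ X, cellDist cA c' ≤ k + 1) ∧ ∃ c' ∈ X, cellDist cB c' ≤ k + 1

open Classical in
/-- The touching-component of `γ` in `Δ`: members of `Δ` joined to `γ` by a chain of members of `Δ`, consecutive ones
touching. -/
def comp (Δ : Finset (Finset (Cell q))) (γ : Finset (Cell q)) : Finset (Finset (Cell q)) :=
  Δ.filter fun δ => Relation.ReflTransGen (fun x y => x ∈ Δ ∧ y ∈ Δ ∧ ∃ c ∈ x, ∃ c' ∈ y, cellDist c c' ≤ 6) γ δ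

/-- Membership in `cells`. -/
theorem mem_cells {F : Finset (Finset (Cell q))} {c : Cell q} : c ∈ cells F ↔ ∃ δ ∈ F, c ∈ δ := by
  simp [cells]

/-- A member of a family is contained in its cells. -/
theorem subset_cells {F : Finset (Finset (Cell q))} {δ : Finset (Cell q)} (hδ : δ ∈ F) : δ ⊆ cells F :=
  (subset_biUnion_of_mem id hδ : δ ⊆ cells F)

/-- `cells` of a union. -/
theorem cells_union (F F' : Finset (Finset (Cell q))) : cells (F ∪ F') = cells F ∪ cells F' := by
  classical
  ext c; simp [cells, mem_biUnion, or_and_right, exists_or]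

/-- Symmetry of `ReflTransGen` for a symmetric relation. -/
theorem rtg_symm {α : Type*} {r : α → α → Prop} (h : ∀ ⦃x y : α⦄, r x y → r y x) {a b : α}
    (hab : Relation.ReflTransGen r a b) : Relation.ReflTransGen r b a := by
  induction hab with
  | refl => exact Relation.ReflTransGen.refl
  | tail _ hbc ih => exact Relation.ReflTransGen.head (h hbc) ih

/-- Touching (inside `Δ`) is a symmetric relation. -/
theorem touch_symmetric (Δ : Finset (Finset (Cell q))) :
    ∀ ⦃x y : Finset (Cell q)⦄, (x ∈ Δ ∧ y ∈ Δ ∧ ∃ c ∈ x, ∃ c' ∈ y, cellDist c c' ≤ 6) →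
      (y ∈ Δ ∧ x ∈ Δ ∧ ∃ c ∈ y, ∃ c' ∈ x, cellDist c c' ≤ 6) :=
  fun x y ⟨hx, hy, c, hc, c', hc', hd⟩ => ⟨hy, hx, c', hc', c, hc, by rwa [cellDist_comm]⟩

/-- A touching-component of `Δ` is a sub-family of `Δ`. -/
theorem comp_subset (Δ : Finset (Finset (Cell q))) (γ : Finset (Cell q)) : comp Δ γ ⊆ Δ := by
  classical
  exact filter_subset _ _

/-- Membership in a touching-component. -/
theorem mem_comp {Δ : Finset (Finset (Cell q))} {γ δ : Finset (Cell q)} :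
    δ ∈ comp Δ γ ↔ δ ∈ Δ ∧
      Relation.ReflTransGen (fun x y => x ∈ Δ ∧ y ∈ Δ ∧ ∃ c ∈ x, ∃ c' ∈ y, cellDist c c' ≤ 6) γ δ := by
  classical
  exact mem_filter

/-- `γ ∈ Δ` lies in its own touching-component. -/
theorem self_mem_comp {Δ : Finset (Finset (Cell q))} {γ : Finset (Cell q)} (hγ : γ ∈ Δ) : γ ∈ comp Δ γ :=
  mem_comp.2 ⟨hγ, Relation.ReflTransGen.refl⟩

/-- A sub-family of a compatible family is compatible. -/
theorem compatible_of_subset {Γ F : Finset (Finset (Cell q))} (hΓ : Compatible Γ) (hF : F ⊆ Γ) : Compatible F :=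
  ⟨fun γ hγ => hΓ.1 γ (hF hγ), fun γ hγ γ' hγ' hne => hΓ.2 γ (hF hγ) γ' (hF hγ') hne⟩

/-! ## §2 The swap: an involution preserving the union, the `B`-cluster, the good event, compatibility and the product of
activities; its effect on near families; it is a swapping map -/

section Swap

variable (cA cB : Cell q) (k : ℕ)

/-- Exchanging on `K` preserves the union of the two families. -/
theorem swapWith_union (K : Finset (Finset (Cell q))) (p : Finset (Finset (Cell q)) × Finset (Finset (Cell q))) :
    (swapWith K p).1 ∪ (swapWith K p).2 = p.1 ∪ p.2 := by
  ext γ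
  simp only [swapWith, mem_union, mem_sdiff, mem_inter]
  tauto

/-- Exchanging twice on the same `K` is the identity. -/
theorem swapWith_swapWith (K : Finset (Finset (Cell q))) (p : Finset (Finset (Cell q)) × Finset (Finset (Cell q))) :
    swapWith K (swapWith K p) = p := by
  apply Prod.ext
  · ext γ
    simp only [swapWith, mem_union, mem_sdiff, mem_inter]
    tauto
  · ext γ
    simp only [swapWith, mem_union, mem_sdiff, mem_inter]
    tauto

/-- The swap preserves the union of the two copies. -/
theorem swap_union (p : Finset (Finset (Cell q)) × Finset (Finset (Cell q))) :
    (swap cB k p).1 ∪ (swap cB k p).2 = p.1 ∪ p.2 :=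
  swapWith_union _ _

/-- The swap is an involution. -/
theorem swap_swap (p : Finset (Finset (Cell q)) × Finset (Finset (Cell q))) : swap cB k (swap cB k p) = p := by
  have h : (swap cB k p).1 ∪ (swap cB k p).2 = p.1 ∪ p.2 := swap_union cB k p
  unfold swap at h ⊢
  rw [h]
  exact swapWith_swapWith _ _

/-- Membership in the good event. -/
theorem mem_good_iff (p : Finset (Finset (Cell q)) × Finset (Finset (Cell q))) :
    p ∈ good cA cB k ↔ ∀ γ ∈ clusterB (p.1 ∪ p.2) cB k, ∀ c' ∈ γ, k + 1 < cellDist cA c' := by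
  classical
  simp only [good, mem_filter, mem_univ, true_and]

/-- The good event is swap-invariant (it depends on the union only). -/
theorem swap_mem_good_iff (p : Finset (Finset (Cell q)) × Finset (Finset (Cell q))) :
    swap cB k p ∈ good cA cB k ↔ p ∈ good cA cB k := by
  rw [mem_good_iff, mem_good_iff, swap_union]

/-- Membership in the `B`-cluster. -/
theorem mem_clusterB_iff {Δ : Finset (Finset (Cell q))} {γ : Finset (Cell q)} :
    γ ∈ clusterB Δ cB k ↔ γ ∈ Δ ∧ ∃ γ₀ ∈ Δ, (∃ c' ∈ γ₀, cellDist cB c' ≤ k + 1) ∧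
      Relation.ReflTransGen (fun x y => x ∈ Δ ∧ y ∈ Δ ∧ ∃ c ∈ x, ∃ c' ∈ y, cellDist c c' ≤ 6) γ₀ γ := by
  classical
  exact mem_filter

/-- The `B`-cluster of `Δ` is a sub-family of `Δ`. -/
theorem clusterB_subset (Δ : Finset (Finset (Cell q))) : clusterB Δ cB k ⊆ Δ := fun _ h => ((mem_clusterB_iff cB k).1 h).1

/-- The `B`-cluster is closed under touching inside `Δ`. -/
theorem mem_clusterB_of_touch {Δ : Finset (Finset (Cell q))} {γ γ' : Finset (Cell q)} (hγ' : γ' ∈ clusterB Δ cB k)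
    (hγ : γ ∈ Δ) (htouch : ∃ c ∈ γ', ∃ c' ∈ γ, cellDist c c' ≤ 6) : γ ∈ clusterB Δ cB k := by
  obtain ⟨hγ'Δ, γ₀, hγ₀, hγ₀B, hpath⟩ := (mem_clusterB_iff cB k).1 hγ'
  exact (mem_clusterB_iff cB k).2 ⟨hγ, γ₀, hγ₀, hγ₀B, hpath.tail ⟨hγ'Δ, hγ, htouch⟩⟩

/-- Every near-`B` member of `Δ` is in the `B`-cluster. -/
theorem mem_clusterB_of_near {Δ : Finset (Finset (Cell q))} {γ : Finset (Cell q)} (hγ : γ ∈ Δ)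
    (hB : ∃ c' ∈ γ, cellDist cB c' ≤ k + 1) : γ ∈ clusterB Δ cB k :=
  (mem_clusterB_iff cB k).2 ⟨hγ, γ, hγ, hB, Relation.ReflTransGen.refl⟩

/-- Mixing two compatible families along a touching-closed set `K` gives a compatible family. -/
theorem compatible_mix {A B K : Finset (Finset (Cell q))} (hA : Compatible A) (hB : Compatible B)
    (hK : ∀ γ, γ ∈ A ∨ γ ∈ B → ∀ γ' ∈ K, (∃ c ∈ γ', ∃ c' ∈ γ, cellDist c c' ≤ 6) → γ ∈ K) :
    Compatible ((A \ K) ∪ (B ∩ K)) := by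
  refine ⟨fun γ hγ => ?_, fun γ hγ γ' hγ' hne c hc c' hc' => ?_⟩
  · rcases mem_union.1 hγ with h | h
    · exact hA.1 γ (mem_sdiff.1 h).1
    · exact hB.1 γ (mem_inter.1 h).1
  · rcases mem_union.1 hγ with h | h <;> rcases mem_union.1 hγ' with h' | h'
    · exact hA.2 γ (mem_sdiff.1 h).1 γ' (mem_sdiff.1 h').1 hne c hc c' hc'
    · -- `γ ∈ A ∖ K`, `γ' ∈ B ∩ K`: a touch would put `γ` in `K`
      by_contra hlt
      have hle : cellDist c' c ≤ 6 := by rw [cellDist_comm]; omega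
      exact (mem_sdiff.1 h).2 (hK γ (Or.inl (mem_sdiff.1 h).1) γ' (mem_inter.1 h').2 ⟨c', hc', c, hc, hle⟩)
    · by_contra hlt
      have hle : cellDist c c' ≤ 6 := by omega
      exact (mem_sdiff.1 h').2 (hK γ' (Or.inl (mem_sdiff.1 h').1) γ (mem_inter.1 h).2 ⟨c, hc, c', hc', hle⟩)
    · exact hB.2 γ (mem_inter.1 h).1 γ' (mem_inter.1 h').1 hne c hc c' hc'

/-- The swap preserves compatibility of the first copy … -/
theorem compatible_swap_fst {p : Finset (Finset (Cell q)) × Finset (Finset (Cell q))} (h1 : Compatible p.1)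
    (h2 : Compatible p.2) : Compatible (swap cB k p).1 :=
  compatible_mix h1 h2 fun _ hγ _ hγ' ht =>
    mem_clusterB_of_touch cB k hγ' (mem_union.2 hγ) ht

/-- … and of the second copy. -/
theorem compatible_swap_snd {p : Finset (Finset (Cell q)) × Finset (Finset (Cell q))} (h1 : Compatible p.1)
    (h2 : Compatible p.2) : Compatible (swap cB k p).2 :=
  compatible_mix h2 h1 fun _ hγ _ hγ' ht =>
    mem_clusterB_of_touch cB k hγ' (mem_union.2 hγ.symm) ht

/-- The swap permutes the activities. -/
theorem prod_swap (p : Finset (Finset (Cell q)) × Finset (Finset (Cell q))) (f : Finset (Cell q) → ℝ) :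
    (∏ γ ∈ (swap cB k p).1, f γ) * ∏ γ ∈ (swap cB k p).2, f γ = (∏ γ ∈ p.1, f γ) * ∏ γ ∈ p.2, f γ := by
  set K := clusterB (p.1 ∪ p.2) cB k with hK
  have hd1 : Disjoint (p.1 \ K) (p.2 ∩ K) :=
    disjoint_left.2 fun γ h h' => (mem_sdiff.1 h).2 (mem_inter.1 h').2
  have hd2 : Disjoint (p.2 \ K) (p.1 ∩ K) :=
    disjoint_left.2 fun γ h h' => (mem_sdiff.1 h).2 (mem_inter.1 h').2
  show (∏ γ ∈ (p.1 \ K) ∪ (p.2 ∩ K), f γ) * ∏ γ ∈ (p.2 \ K) ∪ (p.1 ∩ K), f γ = _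
  rw [prod_union hd1, prod_union hd2, ← prod_inter_mul_prod_sdiff p.1 K f, ← prod_inter_mul_prod_sdiff p.2 K f]
  ring

/-- On the good event the near-`A` family of the first copy is unchanged by the swap … -/
theorem nearFamily_swap_fst_A {p : Finset (Finset (Cell q)) × Finset (Finset (Cell q))} (hE : p ∈ good cA cB k) :
    nearFamily (swap cB k p).1 cA k = nearFamily p.1 cA k := by
  rw [mem_good_iff] at hE
  set K := clusterB (p.1 ∪ p.2) cB k with hK
  have hKA : ∀ γ ∈ K, ¬ ∃ c' ∈ γ, cellDist cA c' ≤ k + 1 := fun γ hγ ⟨c', hc', hd⟩ =>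
    absurd (hE γ hγ c' hc') (not_lt.2 hd)
  ext γ
  simp only [nearFamily, mem_filter]
  show γ ∈ (p.1 \ K) ∪ (p.2 ∩ K) ∧ _ ↔ _
  rw [mem_union, mem_sdiff, mem_inter]
  constructor
  · rintro ⟨(⟨h1, -⟩ | ⟨-, hK'⟩), hA⟩
    · exact ⟨h1, hA⟩
    · exact absurd hA (hKA γ hK')
  · rintro ⟨h1, hA⟩
    exact ⟨Or.inl ⟨h1, fun hK' => hKA γ hK' hA⟩, hA⟩

/-- … and its near-`B` family is that of the second copy. -/
theorem nearFamily_swap_fst_B (p : Finset (Finset (Cell q)) × Finset (Finset (Cell q))) :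
    nearFamily (swap cB k p).1 cB k = nearFamily p.2 cB k := by
  set K := clusterB (p.1 ∪ p.2) cB k with hK
  ext γ
  simp only [nearFamily, mem_filter]
  show γ ∈ (p.1 \ K) ∪ (p.2 ∩ K) ∧ _ ↔ _
  rw [mem_union, mem_sdiff, mem_inter]
  constructor
  · rintro ⟨(⟨h1, hnK⟩ | ⟨h2, -⟩), hB⟩
    · exact absurd (mem_clusterB_of_near cB k (mem_union.2 (Or.inl h1)) hB) hnK
    · exact ⟨h2, hB⟩
  · rintro ⟨h2, hB⟩
    exact ⟨Or.inr ⟨h2, mem_clusterB_of_near cB k (mem_union.2 (Or.inr h2)) hB⟩, hB⟩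

end Swap

/-- **The swap is a swapping map** (Adhikari–Cao, Def. 3.1) for the hard-core gas weight, the good event and the
near-family functionals. -/
theorem swap_isSwappingMap {g : Finset (Finset (Cell q)) → ℝ} {act : Finset (Cell q) → ℝ} {Z : ℝ}
    (hgc : ∀ Γ, ¬ Compatible Γ → g Γ = 0) (hmass : ∀ Γ, Compatible Γ → g Γ = Z⁻¹ * ∏ γ ∈ Γ, act γ)
    (k : ℕ) (cA cB : Cell q) (ΦA ΦB : Finset (Finset (Cell q)) → ℝ) :
    IsSwappingMap g (good cA cB k) (fun Γ => (ΦA (nearFamily Γ cA k) : ℂ)) (fun Γ => (ΦB (nearFamily Γ cB k) : ℂ))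
      (swap cB k) := by
  classical
  refine ⟨⟨fun p hp => ?_, fun p _ p' _ h => ?_, fun p hp => ?_⟩, fun p _ => ?_, fun p hp => ?_⟩
  · exact Finset.mem_coe.2 ((swap_mem_good_iff cA cB k p).2 (Finset.mem_coe.1 hp))
  · rw [← swap_swap cB k p, ← swap_swap cB k p', h]
  · exact ⟨swap cB k p, Finset.mem_coe.2 ((swap_mem_good_iff cA cB k p).2 (Finset.mem_coe.1 hp)), swap_swap cB k p⟩
  · by_cases hc : Compatible p.1 ∧ Compatible p.2
    · rw [hmass _ (compatible_swap_fst cB k hc.1 hc.2), hmass _ (compatible_swap_snd cB k hc.1 hc.2), hmass _ hc.1,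
        hmass _ hc.2]
      calc Z⁻¹ * (∏ γ ∈ (swap cB k p).1, act γ) * (Z⁻¹ * ∏ γ ∈ (swap cB k p).2, act γ)
          = Z⁻¹ * Z⁻¹ * ((∏ γ ∈ (swap cB k p).1, act γ) * ∏ γ ∈ (swap cB k p).2, act γ) := by ring
        _ = Z⁻¹ * Z⁻¹ * ((∏ γ ∈ p.1, act γ) * ∏ γ ∈ p.2, act γ) := by rw [prod_swap]
        _ = _ := by ring
    · have hR : g p.1 * g p.2 = 0 := by
        rcases not_and_or.1 hc with h | h
        · rw [hgc _ h, zero_mul]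
        · rw [hgc _ h, mul_zero]
      have hL : g (swap cB k p).1 * g (swap cB k p).2 = 0 := by
        by_contra hne
        have h1 : Compatible (swap cB k p).1 := by
          by_contra h; exact hne (by rw [hgc _ h, zero_mul])
        have h2 : Compatible (swap cB k p).2 := by
          by_contra h; exact hne (by rw [hgc _ h, mul_zero])
        have h1' := compatible_swap_fst cB k (p := swap cB k p) h1 h2
        have h2' := compatible_swap_snd cB k (p := swap cB k p) h1 h2
        rw [swap_swap] at h1' h2'
        exact hc ⟨h1', h2'⟩
      rw [hL, hR]
  · show (ΦA (nearFamily p.1 cA k) : ℂ) * (ΦB (nearFamily p.2 cB k) : ℂ) =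
      (ΦA (nearFamily (swap cB k p).1 cA k) : ℂ) * (ΦB (nearFamily (swap cB k p).1 cB k) : ℂ)
    rw [nearFamily_swap_fst_A cA cB k hp, nearFamily_swap_fst_B cB k p]

end GasMixing

end Summit.QuantumFields.YangMills.Cruxes.IR.EsPolymer

end
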